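import Summits.Parity.GeneralizedHardyLittlewood.Theorems.LeeYangFibresCellParityLawSavingVariantDefs
import Summits.Parity.GeneralizedHardyLittlewood.Theorems.LeeYangFibresCellParityLawSavingReduceAlong
import Summits.Parity.GeneralizedHardyLittlewood.Theorems.LeeYangFibresAbsoluteUpgradeQuantClipNumerics
import Summits.Parity.GeneralizedHardyLittlewood.Theorems.LeeYangFibresCellParityLawSavingWalshStep
import HarnessLib

/-!
# Route `LeeYangFibres`, crux `CellParityLawSaving` (stmt-Parity-18104), line `superpoly-band-same-atom`
# (payload slug `SketchIdeator3`), VARIANT B: the registered stub `stub_reduceGS` — the polynomial-rate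
# kernel applied ALONG THE SCHEDULE at the Granville–Soundararajan-adjacent deficit

We prove the registered stub `stub_reduceGS : ReduceGS` of the Variant-B skeleton
(vocabulary `LeeYangFibresCellParityLawSavingVariantDefs`):

  `ReduceGS : PolyRoughCellLawUniform → ∀ c ≥ 2, (∀ t ≥ 1, KernelReadyGSAt c t) → ∀ t ≥ 1, RawSectionLawSavAt t`.

This is this line's landed `stub_reduceAlong` (`LeeYangFibresCellParityLawSavingReduceAlong`, the kernel applied
to the Bombieri-normalised localised section sequence along the roughness schedule `u = U(N) = slowDegree N`)
with the POLYNOMIAL-rate kernel `PolyRoughCellLawUniform` (rate `u^{Cu} η^κ` in the level deficit `η`, constants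
uniform in `u`) at the deficit `η = etaGS N c = 2(log N)^{-1/c}`, and the log-power saving `(log N)^{-δ}`,
`δ := min(κ/(2c), 1)/4`.

* Constants. Fix `c ≥ 2`, `t ≥ 1` and `L ≥ 1` (`L = 0` is vacuous: a non-degenerate system has size `≥ 1`). The
  instance `A = 0` of `KernelReadyGSAt c t` supplies the density constant `L'₀ = L'(t, L)`; the kernel at
  `(A₁, L') = (t + 2, L'₀)` supplies `κ, C, A₂, x₀` — BEFORE any roughness is chosen. Then `A := A₂ + t + 3` and
  the working instance of `KernelReadyGSAt c t` at `A` supplies the ranges (including `U(N) ≤ √(log log x)`), the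
  weights, size, density bound, Type-I bound and the three identifications (cells, fibre mass, `V(N^{1/U})`).
* Error terms, with `ℓ = log N`, `U = U(N)`, `4U² ≤ log ℓ` (`exp(4U²) ≤ ℓ`, `quantClip_schedule`):
  (i) the deficit term: `η^κ = 2^κ ℓ^{-κ/c}`; since `log U = o(U)` and `U(N) → ∞`, for `N` large
  `C log U ≤ (κ/c) U`, so `C U log U ≤ (κ/c) U² ≤ (κ/(4c)) log ℓ` and `U^{CU} = e^{CU log U} ≤ ℓ^{κ/(4c)}`; hence
  `C U^{CU} η^κ ≤ C 2^κ ℓ^{-3κ/(4c)} ≤ 1/(4ℓ^δ)` once `4C 2^κ ≤ ℓ^{κ/(2c)}` (`δ ≤ κ/(8c)`);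
  (ii) `(log z)^{-κ} = (U/ℓ)^κ ≤ ℓ^{-κ/2}` and `C ℓ^{-κ/2} ≤ 1/(4ℓ^δ)` (`ReduceAlongAux.logz_term_le`, `δ ≤ κ/4`);
  (iii) `C log(2Λ)/log z ≤ 1/(4ℓ^δ)` (`ReduceAlongAux.lam_term_le`, `δ ≤ 1/2`);
  (iv) `C (log x)^{A₂} R ≤ N/log^{t+2} N` for `A = A₂ + t + 3` (`GeThreeReduceAux.eventually_R_term`, verbatim).
  Hence `C((i)+(ii)+(iii)) V F + (iv) ≤ (3/4) V F/ℓ^δ + N/ℓ^{t+2} ≤ V F/ℓ^δ + N/ℓ^{t+2}`.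
  All thresholds depend on `t, L, c, κ, C, A₂, x₀` only — not on the `N`-dependent roughness.

No number theory is used beyond the two hypotheses; no named fact is used.

References: E. Bombieri, *The asymptotic sieve*, Rend. Accad. Naz. XL (5) 1/2 (1975/76) 243–269
[BombieriAsymptoticSieve1976]; E. Bombieri, RIMS Kôkyûroku 294 (1977) p. 5 [BombieriRIMS1977]; J. Friedlander,
H. Iwaniec, Ann. Sc. Norm. Sup. Pisa (4) 5 (1978) §4 [FriedlanderIwaniecPisa1978]; K. Ford, Trans. AMS 357 (2005)
[Ford2004]; K. Alladi, Quart. J. Math. 33 (1982) [Alladi1982]; A. Granville, K. Soundararajan, Ann. of Math. 165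
(2007) [GranvilleSoundararajan2007] for the level scale.
-/

noncomputable section

open scoped BigOperators Classical
open Finset Filter Literature.NumberTheory.Sieve
open Summit.Parity.GeneralizedHardyLittlewood.Cruxes.CellParityLaw.SectionAnnihilator
open Summit.Parity.GeneralizedHardyLittlewood.Cruxes.AbsoluteUpgrade.DipMarginRateExchange (slowDegree
  four_le_slowDegree quantClip_schedule)

namespace Summit.Parity.GeneralizedHardyLittlewood.Cruxes.CellParityLawSaving.SuperPolyBand

namespace ReduceGSAux

/-- `log U = o(U)` made effective along the naturals: for `C ≥ 0` and `a > 0` there is `U₀` with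
`C log U ≤ a U` for every natural `U ≥ U₀` (Mathlib's `Real.isLittleO_log_id_atTop`). -/
theorem exists_log_le_mul {C a : ℝ} (hC : 0 ≤ C) (ha : 0 < a) :
    ∃ U₀ : ℕ, ∀ U : ℕ, U₀ ≤ U → C * Real.log U ≤ a * U := by
  have h := Real.isLittleO_log_id_atTop.bound (show (0 : ℝ) < a / (C + 1) by positivity)
  obtain ⟨U₀, hU₀⟩ := Filter.eventually_atTop.1
    (tendsto_natCast_atTop_atTop.eventually (h.and (eventually_ge_atTop (1 : ℝ))))
  refine ⟨U₀, fun U hU => ?_⟩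
  obtain ⟨hb, hU1⟩ := hU₀ U hU
  simp only [id_eq, Real.norm_eq_abs, abs_of_nonneg (Real.log_nonneg hU1),
    abs_of_pos (show (0 : ℝ) < U by linarith)] at hb
  have hU0 : (0 : ℝ) ≤ U := by linarith
  calc C * Real.log U ≤ C * (a / (C + 1) * U) := mul_le_mul_of_nonneg_left hb hC
    _ = C / (C + 1) * (a * U) := by ring
    _ ≤ 1 * (a * U) := by
        refine mul_le_mul_of_nonneg_right ?_ (by positivity)
        rw [div_le_one (by linarith)]
        linarith
    _ = a * U := one_mul _

/-- **The roughness prefactor along the schedule.** With `U ≥ 1`, `C log U ≤ a U` (`a ≥ 0`), `4U² ≤ log ℓ`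
and `ℓ ≥ 1`: `U^{CU} = e^{CU log U} ≤ e^{a U²} ≤ e^{(a/4) log ℓ} = ℓ^{a/4}`. -/
theorem upow_le {C a ℓ U : ℝ} (hU : 1 ≤ U) (ha : 0 ≤ a) (hlogU : C * Real.log U ≤ a * U)
    (h4U : 4 * U ^ 2 ≤ Real.log ℓ) (hℓ : 1 ≤ ℓ) : U ^ (C * U) ≤ ℓ ^ (a / 4) := by
  have hU0 : 0 < U := by linarith
  have hℓ0 : 0 < ℓ := by linarith
  rw [Real.rpow_def_of_pos hU0, Real.rpow_def_of_pos hℓ0, Real.exp_le_exp]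
  calc Real.log U * (C * U) = U * (C * Real.log U) := by ring
    _ ≤ U * (a * U) := mul_le_mul_of_nonneg_left hlogU hU0.le
    _ = a * U ^ 2 := by ring
    _ ≤ a * (Real.log ℓ / 4) := mul_le_mul_of_nonneg_left (by linarith) ha
    _ = Real.log ℓ * (a / 4) := by ring

/-- **Term (i) in Variant B (the deficit term).** With `ℓ = log N ≥ 1`, `η = 2 ℓ^{-1/c}` (so
`η^κ = 2^κ ℓ^{-κ/c}`), a prefactor `0 ≤ P ≤ ℓ^{κ/(4c)}`, `δ ≤ κ/(8c)` and `4C 2^κ ≤ ℓ^{κ/(2c)}`: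
`C P η^κ = C 2^κ P ℓ^{-κ/c} ≤ 1/(4ℓ^δ)` (`4C2^κ · P · ℓ^δ ≤ ℓ^{κ/(2c)} ℓ^{κ/(4c)} ℓ^{κ/(4c)} = ℓ^{κ/c}`). -/
theorem eta_term_le {C κ δ ℓ P cc : ℝ} (hC : 0 ≤ C) (hκ : 0 < κ) (hcc : 0 < cc) (hℓ : 1 ≤ ℓ)
    (hP0 : 0 ≤ P) (hP : P ≤ ℓ ^ (κ / cc / 4)) (hδ : δ ≤ κ / cc / 8)
    (h4C : 4 * C * 2 ^ κ ≤ ℓ ^ (κ / cc / 2)) :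
    C * (P * (2 / ℓ ^ (1 / cc)) ^ κ) ≤ 1 / (4 * ℓ ^ δ) := by
  have hℓ0 : 0 < ℓ := by linarith
  have hr0 : 0 < ℓ ^ (1 / cc) := Real.rpow_pos_of_pos hℓ0 _
  have hκc : 0 ≤ κ / cc := div_nonneg hκ.le hcc.le
  have hηκ : (2 / ℓ ^ (1 / cc)) ^ κ = 2 ^ κ / ℓ ^ (κ / cc) := by
    rw [Real.div_rpow zero_le_two hr0.le, ← Real.rpow_mul hℓ0.le]
    congr 2
    field_simp
  rw [hηκ]
  have hq0 : 0 < ℓ ^ (κ / cc / 4) := Real.rpow_pos_of_pos hℓ0 _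
  have hh0 : 0 < ℓ ^ (κ / cc / 2) := Real.rpow_pos_of_pos hℓ0 _
  have hℓδ0 : 0 < ℓ ^ δ := Real.rpow_pos_of_pos hℓ0 δ
  have hℓδ : ℓ ^ δ ≤ ℓ ^ (κ / cc / 4) := Real.rpow_le_rpow_of_exponent_le hℓ (by linarith)
  have h42 : 0 ≤ 4 * C * 2 ^ κ := by positivity
  calc C * (P * (2 ^ κ / ℓ ^ (κ / cc))) = C * 2 ^ κ * P / ℓ ^ (κ / cc) := by ring
    _ ≤ 1 / (4 * ℓ ^ δ) := by
        rw [div_le_div_iff₀ (Real.rpow_pos_of_pos hℓ0 _) (by positivity)]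
        calc C * 2 ^ κ * P * (4 * ℓ ^ δ) = 4 * C * 2 ^ κ * P * ℓ ^ δ := by ring
          _ ≤ ℓ ^ (κ / cc / 2) * ℓ ^ (κ / cc / 4) * ℓ ^ (κ / cc / 4) :=
              mul_le_mul (mul_le_mul h4C hP hP0 hh0.le) hℓδ hℓδ0.le (by positivity)
          _ = 1 * ℓ ^ (κ / cc) := by
              rw [← Real.rpow_add hℓ0, ← Real.rpow_add hℓ0, one_mul]
              congr 1
              ring

end ReduceGSAux

open GeThreeReduceAux PrLawTwoAssemblyAux ReduceAlongAux ReduceGSAux in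
/-- **`stub_reduceGS`** (registered stub of the Variant-B skeleton, line `superpoly-band-same-atom`): the
polynomial-rate kernel `PolyRoughCellLawUniform` applied along the schedule `u = U(N)` at the deficit
`η = etaGS N c = 2(log N)^{-1/c}`, with the saving `δ = min(κ/(2c), 1)/4` — `ReduceGS`. -/
theorem stub_reduceGS : ReduceGS := by
  intro hK c hc hR t ht L
  -- the vacuous case `L = 0`
  rcases Nat.eq_zero_or_pos L with hL0 | hLpos
  · refine ⟨1, one_pos, 0, fun N _ Ψ hΨ hL K _ _ i => ?_⟩
    have h1 : (1 : ℝ) ≤ (L : ℝ) := one_le_of_affLinSize_le Ψ hΨ hL i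
    rw [hL0, Nat.cast_zero] at h1
    exact absurd h1 (by norm_num)
  have hL1 : 1 ≤ L := hLpos
  have hL1r : (1 : ℝ) ≤ L := by exact_mod_cast hL1
  have hc0 : (0 : ℝ) < c := by exact_mod_cast (by omega : 0 < c)
  have hc1 : (1 : ℝ) ≤ c := by exact_mod_cast (by omega : 1 ≤ c)
  -- the density constant `L'₀` (instance `A = 0`) and the kernel's constants, chosen BEFORE `u`
  obtain ⟨L'₀, M₀, h0⟩ := hR t ht L 0
  obtain ⟨κ, C, A₂, x₀, hκ, hC, hKer⟩ := hK ((t : ℝ) + 2) L'₀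
  -- the working instance: `A = A₂ + t + 3`
  set A : ℕ := A₂ + t + 3 with hAdef
  obtain ⟨L'₁, M₁, h1⟩ := hR t ht L A
  -- the saving `δ = min(κ/(2c), 1)/4`
  have hκc : 0 < κ / c := div_pos hκ hc0
  have hκc' : κ / c ≤ κ := div_le_self hκ.le hc1
  set δ : ℝ := min (κ / c / 2) 1 / 4 with hδdef
  have hδ0 : 0 < δ := by rw [hδdef]; positivity
  have hδc : δ ≤ κ / c / 8 := by rw [hδdef]; linarith [min_le_left (κ / c / 2) 1]
  have hδκ : δ ≤ κ / 4 := by linarith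
  have hδ1 : δ ≤ 1 / 2 := by rw [hδdef]; linarith [min_le_right (κ / c / 2) 1]
  have hκ4 : 0 < κ / 4 := by positivity
  have hκc2 : 0 < κ / c / 2 := by positivity
  -- thresholds (independent of the `N`-dependent roughness)
  obtain ⟨U₀, hU₀⟩ := exists_log_le_mul hC hκc
  obtain ⟨N₁, hN₁⟩ := quantClip_schedule U₀
  obtain ⟨N₂, hN₂⟩ := WalshStepSavAux.exists_thresholds (by norm_num : (0 : ℝ) < 1 / 4) hκ4 2 (4 * C)
  obtain ⟨N₃, hN₃⟩ := WalshStepSavAux.exists_thresholds (by norm_num : (0 : ℝ) < 1 / 4)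
    (by norm_num : (0 : ℝ) < 1 / 4) 2 (4 * C * ((t : ℝ) + 3))
  obtain ⟨N₄, hN₄⟩ := WalshStepSavAux.exists_thresholds (by norm_num : (0 : ℝ) < 1 / 4) hκc2 0
    (4 * C * 2 ^ κ)
  obtain ⟨N₀, hN₀⟩ := Filter.eventually_atTop.1 ((eventually_R_term C hC L A₂ t hL1).and
    ((tendsto_natCast_atTop_atTop.eventually_ge_atTop x₀).and ((eventually_ge_atTop M₀).and
    ((eventually_ge_atTop M₁).and ((eventually_ge_atTop N₁).and ((eventually_ge_atTop N₂).and
    ((eventually_ge_atTop N₃).and (eventually_ge_atTop N₄))))))))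
  refine ⟨δ, hδ0, N₀, fun N hN Ψ hΨ hL K hK hKN i j' hj' hlt1 hKT hF0 => ?_⟩
  obtain ⟨hRT, hx₀N, hNM₀, hNM₁, hNN₁, hNN₂, hNN₃, hNN₄⟩ := hN₀ N hN
  obtain ⟨hU₀U, hN16, hexp, -⟩ := hN₁ N hNN₁
  obtain ⟨hℓ1, hll2, h4Cκ⟩ := hN₂ N hNN₂
  obtain ⟨-, -, h4Ct⟩ := hN₃ N hNN₃
  obtain ⟨-, -, h4C2⟩ := hN₄ N hNN₄
  have hN0 : (0 : ℝ) < N := by exact_mod_cast (by omega : 0 < N)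
  have hℓ0 : 0 < Real.log (N : ℝ) := by linarith
  -- the schedule: `4 U² ≤ log log N`, hence `1 ≤ U ≤ log log N`, and `C log U ≤ (κ/c) U`
  have hU4 : (4 : ℝ) ≤ (slowDegree N : ℝ) := by exact_mod_cast four_le_slowDegree N
  have hU1 : (1 : ℝ) ≤ (slowDegree N : ℝ) := by linarith
  have h4U : 4 * (slowDegree N : ℝ) ^ 2 ≤ Real.log (Real.log (N : ℝ)) :=
    (Real.le_log_iff_exp_le hℓ0).2 hexp
  have hUℓℓ : (slowDegree N : ℝ) ≤ Real.log (Real.log (N : ℝ)) := by nlinarith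
  have hlogU : C * Real.log (slowDegree N : ℝ) ≤ κ / c * (slowDegree N : ℝ) := hU₀ _ hU₀U
  -- the two instances of the ready sequence
  obtain ⟨-, -, -, -, -, -, -, hIw0, hlow0, -, -, -, -⟩ :=
    h0 N hNM₀ Ψ hΨ hL K hK hKN i j' hj' hlt1 hKT hF0
  obtain ⟨⟨hsqrt, hz1, hz2, hη1, hη2, hΛ1, hΛ2, hw1, hw2⟩, hwt, hsHi, hsLo, hsize, hszlow, hdensLe, -, -,
    hTI, hcell, hsizeF, hdens⟩ := h1 N hNM₁ Ψ hΨ hL K hK hKN i j' hj' hlt1 hKT hF0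
  -- `x₀ ≤ x = 2LN`
  have hx₀ : x₀ ≤ xOf L N := by
    refine le_trans hx₀N ?_
    change (N : ℝ) ≤ 2 * (L : ℝ) * N
    nlinarith
  -- the kernel, at `u := U(N)`
  obtain ⟨δ', hδ'0, hδ'2, hlaw⟩ := hKer (slowDegree N) (secSeqB Ψ K N (slowDegree N) i j') (xOf L N)
    (zOf N (slowDegree N)) (etaGS N c) (lamOf N t) (wOf N) (rOf N A)
    (le_trans (by norm_num) (four_le_slowDegree N)) hx₀ hsqrt hz1 hz2 hη1 hη2 hΛ1 hΛ2 hw1 hw2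
    hwt hsHi hsLo hsize hszlow hdensLe hIw0 hlow0 hTI
  refine ⟨δ', hδ'0, hδ'2, fun m hm => ?_⟩
  have hm' := hlaw m hm
  rw [hcell m hm, hsizeF, hdens] at hm'
  refine hm'.trans ?_
  -- notation
  set V : ℝ := ∏ p ∈ Nat.primesBelow ⌈zOf N (slowDegree N)⌉₊, (1 - sectionDensity Ψ i p) with hV
  set F : ℝ := (sectionMass Ψ K N (slowDegree N) i j' 1 : ℝ) with hFdef
  have hV0 : 0 ≤ V :=
    prod_one_sub_sectionDensity_nonneg Ψ i _ fun p hp => Nat.prime_of_mem_primesBelow hp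
  have hF0' : 0 ≤ F := Nat.cast_nonneg _
  have hVF : 0 ≤ V * F := mul_nonneg hV0 hF0'
  -- the three relative error terms
  have hlogz : Real.log (zOf N (slowDegree N)) = 1 / (slowDegree N : ℝ) * Real.log N := by
    change Real.log ((N : ℝ) ^ ((1 : ℝ) / (slowDegree N : ℝ))) = _
    rw [Real.log_rpow hN0]
  have hPδ : 0 < Real.log (N : ℝ) ^ δ := Real.rpow_pos_of_pos hℓ0 δ
  have hUpow : (slowDegree N : ℝ) ^ (C * (slowDegree N : ℝ)) ≤ Real.log (N : ℝ) ^ (κ / c / 4) :=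
    upow_le hU1 hκc.le hlogU h4U hℓ1.le
  have hT1 : C * ((slowDegree N : ℝ) ^ (C * (slowDegree N : ℝ)) * etaGS N c ^ κ) ≤
      1 / (4 * Real.log (N : ℝ) ^ δ) :=
    eta_term_le hC hκ hc0 hℓ1.le (Real.rpow_nonneg (by linarith) _) hUpow hδc h4C2
  have hT2 : C * Real.log (zOf N (slowDegree N)) ^ (-κ) ≤ 1 / (4 * Real.log (N : ℝ) ^ δ) := by
    rw [hlogz]
    exact logz_term_le hC hκ hℓ1.le hU1 h4U hδκ h4Cκ
  have hT3 : C * (Real.log (2 * lamOf N t) / Real.log (zOf N (slowDegree N))) ≤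
      1 / (4 * Real.log (N : ℝ) ^ δ) := by
    rw [hlogz]
    exact lam_term_le t hC hℓ1 hU1 hUℓℓ hδ1 hll2 h4Ct
  have h34 : 3 * (1 / (4 * Real.log (N : ℝ) ^ δ)) ≤ 1 / Real.log (N : ℝ) ^ δ := by
    rw [← div_eq_mul_one_div, div_le_div_iff₀ (by positivity) hPδ]
    linarith
  have hrel : C * ((slowDegree N : ℝ) ^ (C * (slowDegree N : ℝ)) * etaGS N c ^ κ +
      Real.log (zOf N (slowDegree N)) ^ (-κ) +
      Real.log (2 * lamOf N t) / Real.log (zOf N (slowDegree N))) ≤ 1 / Real.log (N : ℝ) ^ δ := by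
    calc C * ((slowDegree N : ℝ) ^ (C * (slowDegree N : ℝ)) * etaGS N c ^ κ +
          Real.log (zOf N (slowDegree N)) ^ (-κ) +
          Real.log (2 * lamOf N t) / Real.log (zOf N (slowDegree N)))
        = C * ((slowDegree N : ℝ) ^ (C * (slowDegree N : ℝ)) * etaGS N c ^ κ) +
            C * Real.log (zOf N (slowDegree N)) ^ (-κ) +
            C * (Real.log (2 * lamOf N t) / Real.log (zOf N (slowDegree N))) := by ring
      _ ≤ 1 / (4 * Real.log (N : ℝ) ^ δ) + 1 / (4 * Real.log (N : ℝ) ^ δ) +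
            1 / (4 * Real.log (N : ℝ) ^ δ) := add_le_add (add_le_add hT1 hT2) hT3
      _ = 3 * (1 / (4 * Real.log (N : ℝ) ^ δ)) := by ring
      _ ≤ 1 / Real.log (N : ℝ) ^ δ := h34
  -- the Type-I term
  have hRterm : C * Real.log (xOf L N) ^ A₂ * rOf N A ≤ (N : ℝ) / Real.log N ^ (t + 2) := hRT
  -- conclusion
  calc C * ((slowDegree N : ℝ) ^ (C * (slowDegree N : ℝ)) * etaGS N c ^ κ +
          Real.log (zOf N (slowDegree N)) ^ (-κ) +
          Real.log (2 * lamOf N t) / Real.log (zOf N (slowDegree N))) * (V * F) +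
        C * Real.log (xOf L N) ^ A₂ * rOf N A
      ≤ 1 / Real.log (N : ℝ) ^ δ * (V * F) + (N : ℝ) / Real.log N ^ (t + 2) :=
        add_le_add (mul_le_mul_of_nonneg_right hrel hVF) hRterm
    _ = V * F / Real.log N ^ δ + (N : ℝ) / Real.log N ^ (t + 2) := by ring

end Summit.Parity.GeneralizedHardyLittlewood.Cruxes.CellParityLawSaving.SuperPolyBand

end
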